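import Mathlib.Analysis.SpecialFunctions.Pow.Real
import Mathlib.Algebra.BigOperators.Fin
import Mathlib.Data.Fin.Tuple.Basic
import Literature.Probability.LatticeModels.HardCoreCycleSignedSums
import HarnessLib

/-!
# Hard-core words with a signed interaction at distance two: a three-state transfer potential

**Source of the method.** R. P. Stanley, *Enumerative Combinatorics* I (2nd ed., 2012), §4.7 "The transfer-matrix
method" [Stanley2012EC1]: weighted walks in a digraph are the entries of the powers of its (weighted) adjacency matrix
(Theorem 4.7.1, p. 500) and grow like powers of its eigenvalues (Corollary 4.7.4); a constraint or weight depending on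
several consecutive letters is handled by "making the digraph big enough to incorporate the required past history",
vertices = pairs of consecutive letters (Example 4.7.7, p. 503); a cyclic restriction on `a_n a_1` is counted by closed
walks (Corollary 4.7.3, Example 4.7.6, pp. 501–503).  The hard-core constraint `NoAdj` and the snoc bookkeeping are those
of the companion file `HardCoreCycleSignedSums` (namespace `HardCoreSigned`), which treats a sign per occupied site;
here the sign sits on pairs of zeros at distance two, so the transfer state is the last TWO letters.

Setting.  Boolean words with NO TWO CONSECUTIVE ZEROS (hard-core constraint), each zero weighted by the fugacity `2`,
and a SIGN `−1` for every pair of zeros at distance two (a factor `010`).  With the last two letters as the state, the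
signed partial sums `(E₁₁, E₁₀, E₀₁)` obey the linear recursion
`E₁₁' = E₁₁ + E₀₁`, `E₁₀' = 2E₁₁ − 2E₀₁`, `E₀₁' = E₁₀` (`esum_succ_*`), whose matrix has spectral radius `< √3 < 2`.

SUPPLIED HERE (not printed in this form): the explicit quadratic potential
`qp x y z = 18x² + 12y² + 31z² − 10xy − 20xz − 4yz` satisfies `qp ∘ step ≤ 3 · qp` (`qp_step_le`) and `qp ≥ 6(x²+y²+z²)`
(`qp_ge`), whence every signed partial sum is `O(3^{j/2})` (`abs_esum_le`), exponentially small against the unsigned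
fugacity-2 count `≍ 2^j`.  Application (Summits side, not here): the parity of the number of zero pairs at distance two on the
kernel line of the mod-3 ring game is asymptotically unbiased, so "window-pure" affine strategies win with probability `½ + o(1)`.
Everything is PROVED; no named facts.
-/

noncomputable section

namespace Literature.Probability.LatticeModels

namespace HardCorePairs2

open Finset
open HardCoreSigned (NoAdj)

/-! ## Words, weights [Stanley2012EC1, §4.7.1]

The linear hard-core constraint `NoAdj` (no two consecutive zeros) is `HardCoreSigned.NoAdj` of the companion file. -/

/-- Site factor (the vertex part of the edge weight `w(e)`): fugacity `2` for a zero. [cite: Stanley2012EC1, §4.7.1, Theorem 4.7.1 (weighted walks; pp. 500–501)] -/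
def zf {n : ℕ} (v : Fin n → Bool) (i : Fin n) : ℝ := if v i = false then 2 else 1

/-- Pair factor attached to the LATER site (the weight `−1` of the edge `(ab, bc)` with `a = c = 0` in the digraph on letter
pairs): `−1` if sites `i − 2` and `i` are both zero. [cite: Stanley2012EC1, §4.7, Example 4.7.7 (digraph on pairs of consecutive letters) with Theorem 4.7.1; pp. 500–504] -/
def pf {n : ℕ} (v : Fin n → Bool) (i : Fin n) : ℝ :=
  if h : 2 ≤ i.val then (if v ⟨i.val - 2, by omega⟩ = false ∧ v i = false then -1 else 1) else 1

/-- Signed weight of a word = weight of the corresponding walk: `2^{#zeros} · (−1)^{#{zero pairs at distance two}}`.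
[cite: Stanley2012EC1, §4.7.1, Theorem 4.7.1 (weighted walks; pp. 500–501)] -/
def wt {n : ℕ} (v : Fin n → Bool) : ℝ := ∏ i : Fin n, zf v i * pf v i

/-! ## Snoc bookkeeping [folklore] -/

/-- Site factors of the old sites are unchanged by `snoc`. [folklore] -/
private theorem zf_snoc_castSucc {n : ℕ} (v : Fin (n + 1) → Bool) (d : Bool) (i : Fin (n + 1)) :
    zf (Fin.snoc v d : Fin (n + 2) → Bool) (Fin.castSucc i) = zf v i := by
  unfold zf; rw [Fin.snoc_castSucc]

/-- Pair factors of the old sites are unchanged by `snoc` (they look backwards). [folklore] -/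
private theorem pf_snoc_castSucc {n : ℕ} (v : Fin (n + 1) → Bool) (d : Bool) (i : Fin (n + 1)) :
    pf (Fin.snoc v d : Fin (n + 2) → Bool) (Fin.castSucc i) = pf v i := by
  unfold pf
  by_cases h : 2 ≤ i.val
  · have h' : 2 ≤ (Fin.castSucc i).val := by simpa using h
    rw [dif_pos h', dif_pos h, Fin.snoc_castSucc]
    have e : (⟨(Fin.castSucc i).val - 2, by simp; omega⟩ : Fin (n + 2)) = Fin.castSucc ⟨i.val - 2, by omega⟩ :=
      Fin.ext (by simp)
    rw [e, Fin.snoc_castSucc]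
  · have h' : ¬ 2 ≤ (Fin.castSucc i).val := by simpa using h
    rw [dif_neg h', dif_neg h]

/-- Site factor of the appended letter. [folklore] -/
private theorem zf_snoc_last {n : ℕ} (v : Fin (n + 1) → Bool) (d : Bool) :
    zf (Fin.snoc v d : Fin (n + 2) → Bool) (Fin.last (n + 1)) = if d = false then 2 else 1 := by
  unfold zf; rw [Fin.snoc_last]

/-- The new pair factor looks at the old letter two sites back (`n ≥ 1`). [folklore] -/
private theorem pf_snoc_last {n : ℕ} (hn : 1 ≤ n) (v : Fin (n + 1) → Bool) (d : Bool) :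
    pf (Fin.snoc v d : Fin (n + 2) → Bool) (Fin.last (n + 1)) =
      if v ⟨n - 1, by omega⟩ = false ∧ d = false then -1 else 1 := by
  unfold pf
  have h : 2 ≤ (Fin.last (n + 1)).val := by simp; omega
  rw [dif_pos h, Fin.snoc_last]
  have e : (⟨(Fin.last (n + 1)).val - 2, by simp; omega⟩ : Fin (n + 2)) = Fin.castSucc ⟨n - 1, by omega⟩ :=
    Fin.ext (by simp)
  rw [e, Fin.snoc_castSucc]

/-- Weight of a snoc-extended word: old weight × fugacity of the new letter × the new pair sign. [folklore] -/
private theorem wt_snoc {n : ℕ} (hn : 1 ≤ n) (v : Fin (n + 1) → Bool) (d : Bool) :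
    wt (Fin.snoc v d : Fin (n + 2) → Bool) =
      wt v * (if d = false then 2 else 1) * (if v ⟨n - 1, by omega⟩ = false ∧ d = false then -1 else 1) := by
  unfold wt
  rw [Fin.prod_univ_castSucc, mul_assoc]
  congr 1
  · exact prod_congr rfl fun i _ => by rw [zf_snoc_castSucc, pf_snoc_castSucc]
  · rw [zf_snoc_last, pf_snoc_last hn]

/-- The no-two-zeros constraint of a snoc-extended word. [folklore] -/
private theorem noAdj_snoc_iff {n : ℕ} (v : Fin (n + 1) → Bool) (d : Bool) :
    NoAdj (Fin.snoc v d : Fin (n + 2) → Bool) ↔ (NoAdj v ∧ ¬ (v (Fin.last n) = false ∧ d = false)) := by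
  constructor
  · intro h
    constructor
    · intro i hi hc
      have h' := h (Fin.castSucc i) (by simp; omega)
      apply h'
      have e1 : (⟨(Fin.castSucc i).val + 1, by simp; omega⟩ : Fin (n + 2)) = Fin.castSucc ⟨i.val + 1, hi⟩ :=
        Fin.ext (by simp)
      rw [Fin.snoc_castSucc, e1, Fin.snoc_castSucc]
      exact hc
    · intro hc
      have h' := h (Fin.castSucc (Fin.last n)) (by simp)
      apply h'
      have e1 : (⟨(Fin.castSucc (Fin.last n)).val + 1, by simp⟩ : Fin (n + 2)) = Fin.last (n + 1) :=
        Fin.ext (by simp)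
      rw [Fin.snoc_castSucc, e1, Fin.snoc_last]
      exact hc
  · rintro ⟨hv, hc⟩ i hi hbad
    obtain ⟨hb1, hb2⟩ := hbad
    by_cases hlt : i.val + 1 < n + 1
    · have hi' : i.val < n + 1 := by omega
      have e0 : i = Fin.castSucc ⟨i.val, hi'⟩ := Fin.ext (by simp)
      have e1 : (⟨i.val + 1, hi⟩ : Fin (n + 2)) = Fin.castSucc ⟨i.val + 1, hlt⟩ := Fin.ext (by simp)
      rw [e1, Fin.snoc_castSucc] at hb2
      rw [e0, Fin.snoc_castSucc] at hb1
      exact hv ⟨i.val, hi'⟩ hlt ⟨hb1, hb2⟩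
    · have hiv : i.val = n := by omega
      have e0 : i = Fin.castSucc (Fin.last n) := Fin.ext (by simp [hiv])
      have e1 : (⟨i.val + 1, hi⟩ : Fin (n + 2)) = Fin.last (n + 1) := Fin.ext (by simp [hiv])
      rw [e1, Fin.snoc_last] at hb2
      rw [e0, Fin.snoc_castSucc] at hb1
      exact hc ⟨hb1, hb2⟩

/-- Sums over words of length `n+2` as sums over (last letter, prefix). [folklore] -/
private theorem sum_snoc {n : ℕ} (G : (Fin (n + 2) → Bool) → ℝ) :
    ∑ u : Fin (n + 2) → Bool, G u = ∑ c : Bool, ∑ v : Fin (n + 1) → Bool, G (Fin.snoc v c) := by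
  rw [← (Fin.snocEquiv fun _ : Fin (n + 2) => Bool).sum_comp, Fintype.sum_prod_type]
  rfl

/-! ## Signed partial sums with the last two letters as state [Stanley2012EC1, §4.7, Example 4.7.7] -/

open scoped Classical in
/-- `esum F j b c`: signed weighted sum over hard-core words of length `j + 2` whose last two letters are `(b, c)`,
each word additionally weighted by `F (v 0) (v 1)` (a weight on the FIRST two letters, used to close the cycle) — the
walk sums `A_{ij}(n)` of the digraph whose vertices are pairs of consecutive letters.
[cite: Stanley2012EC1, §4.7, Example 4.7.7 (digraph on pairs of consecutive letters) with Theorem 4.7.1; pp. 500–504] -/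
def esum (F : Bool → Bool → ℝ) (j : ℕ) (b c : Bool) : ℝ :=
  ∑ v : Fin (j + 2) → Bool,
    if (NoAdj v ∧ v ⟨j, by omega⟩ = b ∧ v (Fin.last (j + 1)) = c) then F (v 0) (v ⟨1, by omega⟩) * wt v else 0

/-! ## The transfer recursion (state = last two letters) [Stanley2012EC1, §4.7, Theorem 4.7.1 / Example 4.7.7] -/

/-- The weighted adjacency matrix of the digraph on letter pairs, entry `((b,c), (c,d))`: appending `d` after `(b, c)` is
forbidden if `c = d = 0`, weighs `2` if `d = 0`, and carries the sign `−1` if `b = d = 0`.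
[cite: Stanley2012EC1, §4.7, Example 4.7.7 (digraph on pairs of consecutive letters) with Theorem 4.7.1; pp. 500–504] -/
def coef (b c d : Bool) : ℝ :=
  if (c = false ∧ d = false) then 0 else (if d = false then 2 else 1) * (if (b = false ∧ d = false) then -1 else 1)

/-- Evaluation of a snoc-extended word at an old site given by its value. [folklore] -/
private theorem snoc_at_castSucc {n : ℕ} (u : Fin (n + 1) → Bool) (d : Bool) (k : ℕ) (hk : k < n + 1) :
    (Fin.snoc u d : Fin (n + 2) → Bool) ⟨k, by omega⟩ = u ⟨k, hk⟩ := by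
  have e : (⟨k, by omega⟩ : Fin (n + 2)) = Fin.castSucc ⟨k, hk⟩ := Fin.ext (by simp)
  rw [e, Fin.snoc_castSucc]

/-- **Master recursion** (`A^{n+1} = A^n · A` for the digraph on letter pairs): `esum F (j+1) c d = Σ_b coef b c d · esum F j b c`.
[cite: Stanley2012EC1, §4.7, Example 4.7.7 (digraph on pairs of consecutive letters) with Theorem 4.7.1; pp. 500–504] -/
theorem esum_succ (F : Bool → Bool → ℝ) (j : ℕ) (c d : Bool) :
    esum F (j + 1) c d = ∑ b : Bool, coef b c d * esum F j b c := by
  classical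
  unfold esum
  -- split the word of length j+3 as snoc u e
  rw [sum_snoc, Fintype.sum_bool]
  -- the term with appended letter e ≠ d vanishes; treat both values of d
  have hkill : ∀ e : Bool, e ≠ d →
      (∑ u : Fin (j + 2) → Bool,
        (if (NoAdj (Fin.snoc u e : Fin (j + 3) → Bool) ∧ (Fin.snoc u e : Fin (j + 3) → Bool) ⟨j + 1, by omega⟩ = c ∧
              (Fin.snoc u e : Fin (j + 3) → Bool) (Fin.last (j + 2)) = d)
          then F ((Fin.snoc u e : Fin (j + 3) → Bool) 0) ((Fin.snoc u e : Fin (j + 3) → Bool) ⟨1, by omega⟩) *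
              wt (Fin.snoc u e : Fin (j + 3) → Bool) else 0)) = 0 := by
    intro e he
    refine sum_eq_zero fun u _ => ?_
    rw [Fin.snoc_last]
    simp [he]
  -- the surviving term, summand-wise
  have hkeep : (∑ u : Fin (j + 2) → Bool,
        (if (NoAdj (Fin.snoc u d : Fin (j + 3) → Bool) ∧ (Fin.snoc u d : Fin (j + 3) → Bool) ⟨j + 1, by omega⟩ = c ∧
              (Fin.snoc u d : Fin (j + 3) → Bool) (Fin.last (j + 2)) = d)
          then F ((Fin.snoc u d : Fin (j + 3) → Bool) 0) ((Fin.snoc u d : Fin (j + 3) → Bool) ⟨1, by omega⟩) *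
              wt (Fin.snoc u d : Fin (j + 3) → Bool) else 0))
      = ∑ b : Bool, coef b c d * ∑ u : Fin (j + 2) → Bool,
          (if (NoAdj u ∧ u ⟨j, by omega⟩ = b ∧ u (Fin.last (j + 1)) = c) then F (u 0) (u ⟨1, by omega⟩) * wt u else 0) := by
    rw [Fintype.sum_bool, mul_sum, mul_sum, ← sum_add_distrib]
    refine sum_congr rfl fun u _ => ?_
    have e0 : (Fin.snoc u d : Fin (j + 3) → Bool) 0 = u 0 := by
      have : (0 : Fin (j + 3)) = Fin.castSucc (0 : Fin (j + 2)) := Fin.ext (by simp)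
      rw [this, Fin.snoc_castSucc]
    have e1 : (Fin.snoc u d : Fin (j + 3) → Bool) ⟨1, by omega⟩ = u ⟨1, by omega⟩ := snoc_at_castSucc u d 1 (by omega)
    have ej1 : (Fin.snoc u d : Fin (j + 3) → Bool) ⟨j + 1, by omega⟩ = u (Fin.last (j + 1)) := by
      have : (⟨j + 1, by omega⟩ : Fin (j + 3)) = Fin.castSucc (Fin.last (j + 1)) := Fin.ext (by simp)
      rw [this, Fin.snoc_castSucc]
    have ej : (⟨(j + 1) - 1, by omega⟩ : Fin (j + 2)) = ⟨j, by omega⟩ := Fin.ext (by simp)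
    rw [Fin.snoc_last, e0, e1, ej1, noAdj_snoc_iff, wt_snoc (by omega) u d, ej]
    -- now a case analysis on the letters
    unfold coef
    by_cases hN : NoAdj u
    · cases hb : u ⟨j, by omega⟩ <;> cases hc : u (Fin.last (j + 1)) <;> cases c <;> cases d <;> simp [hN] <;> ring
    · simp [hN]
  cases d
  · -- d = false: surviving term is e = false (second summand)
    rw [hkill true (by decide), zero_add, hkeep]
  · rw [hkill false (by decide), add_zero, hkeep]

/-- Words cannot end in two zeros (the vertex `00` is never used, cf. "the vertex 12 is never used" in Example 4.7.7).
[cite: Stanley2012EC1, §4.7, Example 4.7.7 (digraph on pairs of consecutive letters) with Theorem 4.7.1; pp. 500–504] -/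
theorem esum_false_false (F : Bool → Bool → ℝ) (j : ℕ) : esum F j false false = 0 := by
  classical
  unfold esum
  refine sum_eq_zero fun v _ => ?_
  split_ifs with h
  · exfalso
    obtain ⟨hN, hb, hc⟩ := h
    have hlt : (⟨j, by omega⟩ : Fin (j + 2)).val + 1 < j + 2 := by simp
    refine hN ⟨j, by omega⟩ hlt ⟨hb, ?_⟩
    have e : (⟨(⟨j, by omega⟩ : Fin (j + 2)).val + 1, hlt⟩ : Fin (j + 2)) = Fin.last (j + 1) := Fin.ext (by simp)
    rw [e]; exact hc
  · rfl

/-- The recursion written out, row `11`: `E₁₁' = E₁₁ + E₀₁`. [cite: Stanley2012EC1, §4.7, Example 4.7.7 (digraph on pairs of consecutive letters) with Theorem 4.7.1; pp. 500–504] -/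
theorem esum_succ_tt (F : Bool → Bool → ℝ) (j : ℕ) :
    esum F (j + 1) true true = esum F j true true + esum F j false true := by
  rw [esum_succ, Fintype.sum_bool]; unfold coef; simp

/-- The recursion written out, row `10`: `E₁₀' = 2E₁₁ − 2E₀₁`. [cite: Stanley2012EC1, §4.7, Example 4.7.7 (digraph on pairs of consecutive letters) with Theorem 4.7.1; pp. 500–504] -/
theorem esum_succ_tf (F : Bool → Bool → ℝ) (j : ℕ) :
    esum F (j + 1) true false = 2 * esum F j true true - 2 * esum F j false true := by
  rw [esum_succ, Fintype.sum_bool]; unfold coef; simp; ring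

/-- The recursion written out, row `01`: `E₀₁' = E₁₀`. [cite: Stanley2012EC1, §4.7, Example 4.7.7 (digraph on pairs of consecutive letters) with Theorem 4.7.1; pp. 500–504] -/
theorem esum_succ_ft (F : Bool → Bool → ℝ) (j : ℕ) :
    esum F (j + 1) false true = esum F j true false := by
  rw [esum_succ, Fintype.sum_bool, esum_false_false]; unfold coef; simp

/-! ## The quadratic potential (SUPPLIED HERE) -/

/-- `qp x y z = 18x² + 12y² + 31z² − 10xy − 20xz − 4yz`, a positive definite form adapted to the signed step
`(x,y,z) ↦ (x+z, 2x−2z, y)` (twice a rounding of the solution of the Lyapunov equation `SᵀQS = 3(Q − I)`). [folklore] -/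
def qp (x y z : ℝ) : ℝ := 18 * x ^ 2 + 12 * y ^ 2 + 31 * z ^ 2 - 10 * x * y - 20 * x * z - 4 * y * z

/-- **Contraction**: the potential grows by at most the factor `3` under the signed step
(`3·qp − qp∘step = 8x² − 2xy + 5y² + 7z² ≥ 0`); i.e. the transfer matrix has spectral radius `≤ √3`.
[cite: Stanley2012EC1, §4.7, Corollary 4.7.4 (walk sums grow like powers of the eigenvalues); the explicit potential inequality is supplied here] -/
theorem qp_step_le (x y z : ℝ) : qp (x + z) (2 * x - 2 * z) y ≤ 3 * qp x y z := by
  unfold qp; nlinarith [sq_nonneg (8 * x - y), sq_nonneg y, sq_nonneg z]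

/-- **Coercivity**: `qp ≥ 6 (x² + y² + z²)`. [cite: Stanley2012EC1, §4.7, Corollary 4.7.4 (walk sums grow like powers of the eigenvalues); the explicit potential inequality is supplied here] -/
theorem qp_ge (x y z : ℝ) : 6 * (x ^ 2 + y ^ 2 + z ^ 2) ≤ qp x y z := by
  unfold qp; nlinarith [sq_nonneg (12 * x - 5 * y - 10 * z), sq_nonneg (47 * y - 74 * z), sq_nonneg z]

/-- The potential is non-negative. [folklore] -/
private theorem qp_nonneg (x y z : ℝ) : 0 ≤ qp x y z := le_trans (by positivity) (qp_ge x y z)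

/-- The potential of the state vector `(E₁₁, E₁₀, E₀₁)` after `j` steps. [folklore] -/
def pot (F : Bool → Bool → ℝ) (j : ℕ) : ℝ := qp (esum F j true true) (esum F j true false) (esum F j false true)

/-- **Potential bound along the recursion**: `pot F j ≤ 3^j · pot F 0`. [cite: Stanley2012EC1, §4.7, Theorem 4.7.1 and Corollary 4.7.4; bound supplied here] -/
theorem pot_le (F : Bool → Bool → ℝ) (j : ℕ) : pot F j ≤ 3 ^ j * pot F 0 := by
  induction j with
  | zero => simp
  | succ j ih =>
    have hstep : pot F (j + 1) ≤ 3 * pot F j := by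
      unfold pot
      rw [esum_succ_tt, esum_succ_tf, esum_succ_ft]
      exact qp_step_le _ _ _
    calc pot F (j + 1) ≤ 3 * pot F j := hstep
      _ ≤ 3 * (3 ^ j * pot F 0) := by nlinarith [qp_nonneg (esum F 0 true true) (esum F 0 true false) (esum F 0 false true)]
      _ = 3 ^ (j + 1) * pot F 0 := by ring

/-- **Every signed partial sum is `O(3^{j/2})`**: `(esum F j b c)² ≤ 3^j · pot F 0 / 6` for each end state.
[cite: Stanley2012EC1, §4.7, Theorem 4.7.1 and Corollary 4.7.4; bound supplied here] -/
theorem esum_sq_le (F : Bool → Bool → ℝ) (j : ℕ) (b c : Bool) :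
    (esum F j b c) ^ 2 ≤ 3 ^ j * pot F 0 / 6 := by
  have hp := pot_le F j
  have hq : 6 * ((esum F j true true) ^ 2 + (esum F j true false) ^ 2 + (esum F j false true) ^ 2) ≤ pot F j :=
    qp_ge _ _ _
  have h0 : 0 ≤ pot F 0 := qp_nonneg _ _ _
  have h3 : (0 : ℝ) ≤ 3 ^ j * pot F 0 := by positivity
  have s1 := sq_nonneg (esum F j true true)
  have s2 := sq_nonneg (esum F j true false)
  have s3 := sq_nonneg (esum F j false true)
  cases b <;> cases c
  · rw [esum_false_false]; nlinarith
  · nlinarith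
  · nlinarith
  · nlinarith

/-! ## The base of the recursion: words of length two -/

/-- Words of length two weigh at most `4` in absolute value. [folklore] -/
private theorem abs_wt_two_le (v : Fin 2 → Bool) : |wt v| ≤ 4 := by
  unfold wt
  rw [Finset.abs_prod, Fin.prod_univ_two]
  have h : ∀ i : Fin 2, |zf v i * pf v i| ≤ 2 := by
    intro i
    have hz : |zf v i| ≤ 2 := by unfold zf; split_ifs <;> norm_num
    have hp : |pf v i| ≤ 1 := by
      unfold pf; split_ifs <;> norm_num
    rw [abs_mul]
    nlinarith [abs_nonneg (zf v i), abs_nonneg (pf v i)]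
  nlinarith [h 0, h 1, abs_nonneg (zf v 0 * pf v 0), abs_nonneg (zf v 1 * pf v 1)]

/-- `|E₀| ≤ 16` for any initial weight `|F| ≤ 1`. [folklore] -/
private theorem abs_esum_zero_le (F : Bool → Bool → ℝ) (hF : ∀ a b, |F a b| ≤ 1) (b c : Bool) : |esum F 0 b c| ≤ 16 := by
  classical
  unfold esum
  calc |∑ v : Fin 2 → Bool, (if (NoAdj v ∧ v ⟨0, by omega⟩ = b ∧ v (Fin.last 1) = c) then F (v 0) (v ⟨1, by omega⟩) * wt v else 0)|
      ≤ ∑ v : Fin 2 → Bool, |(if (NoAdj v ∧ v ⟨0, by omega⟩ = b ∧ v (Fin.last 1) = c) then F (v 0) (v ⟨1, by omega⟩) * wt v else 0)| :=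
        abs_sum_le_sum_abs _ _
    _ ≤ ∑ _v : Fin 2 → Bool, (4 : ℝ) := by
        refine sum_le_sum fun v _ => ?_
        split_ifs
        · rw [abs_mul]
          nlinarith [hF (v 0) (v ⟨1, by omega⟩), abs_wt_two_le v, abs_nonneg (F (v 0) (v ⟨1, by omega⟩)), abs_nonneg (wt v)]
        · simp
    _ = 16 := by simp; norm_num

/-- A crude bound of the potential on a box. [folklore] -/
private theorem qp_le_of_abs_le {x y z : ℝ} (hx : |x| ≤ 16) (hy : |y| ≤ 16) (hz : |z| ≤ 16) : qp x y z ≤ 24320 := by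
  have hx2 : x ^ 2 ≤ 256 := by nlinarith [abs_nonneg x, sq_abs x]
  have hy2 : y ^ 2 ≤ 256 := by nlinarith [abs_nonneg y, sq_abs y]
  have hz2 : z ^ 2 ≤ 256 := by nlinarith [abs_nonneg z, sq_abs z]
  have hxy : -(10 * x * y) ≤ 5 * (x ^ 2 + y ^ 2) := by nlinarith [sq_nonneg (x + y)]
  have hxz : -(20 * x * z) ≤ 10 * (x ^ 2 + z ^ 2) := by nlinarith [sq_nonneg (x + z)]
  have hyz : -(4 * y * z) ≤ 2 * (y ^ 2 + z ^ 2) := by nlinarith [sq_nonneg (y + z)]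
  unfold qp
  linarith

/-- `pot F 0 ≤ 24320` for `|F| ≤ 1`. [folklore] -/
private theorem pot_zero_le (F : Bool → Bool → ℝ) (hF : ∀ a b, |F a b| ≤ 1) : pot F 0 ≤ 24320 :=
  qp_le_of_abs_le (abs_esum_zero_le F hF true true) (abs_esum_zero_le F hF true false) (abs_esum_zero_le F hF false true)

/-- **Signed partial sums from a bounded start**: `|esum F j b c| ≤ √(4054 · 3^j)` for `|F| ≤ 1`.
[cite: Stanley2012EC1, §4.7, Theorem 4.7.1 and Corollary 4.7.4; bound supplied here] -/
theorem abs_esum_le (F : Bool → Bool → ℝ) (hF : ∀ a b, |F a b| ≤ 1) (j : ℕ) (b c : Bool) :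
    |esum F j b c| ≤ Real.sqrt (4054 * 3 ^ j) := by
  apply Real.abs_le_sqrt
  have h := esum_sq_le F j b c
  have h0 := pot_zero_le F hF
  have h3 : (0 : ℝ) ≤ 3 ^ j := by positivity
  nlinarith

/-! ## Closing the cycle: zero pairs at cyclic distance two [Stanley2012EC1, §4.7, Corollary 4.7.3 / Example 4.7.6] -/

/-- Cyclic hard-core constraint (no two cyclically adjacent zeros, the restriction on `a_n a_1` of Example 4.7.6) on words
of length `j + 2`; equal to `HardCoreSigned.CycHardCore` up to the order of the two conjuncts. [cite: Stanley2012EC1, §4.7, Corollary 4.7.3 and Example 4.7.6 (cyclic restriction via closed walks; pp. 501–503)] -/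
def CycOK {j : ℕ} (v : Fin (j + 2) → Bool) : Prop := NoAdj v ∧ ¬ (v (Fin.last (j + 1)) = false ∧ v 0 = false)

/-- Cyclic signed weight (weight of the closed walk): the linear weight `wt` times the two wrap-around pair factors (sites
`(j, 0)` and `(j+1, 1)`). [cite: Stanley2012EC1, §4.7, Corollary 4.7.3 and Example 4.7.6 (cyclic restriction via closed walks; pp. 501–503)] -/
def cycWt {j : ℕ} (v : Fin (j + 2) → Bool) : ℝ :=
  wt v * (if v ⟨j, by omega⟩ = false ∧ v 0 = false then -1 else 1) *
    (if v (Fin.last (j + 1)) = false ∧ v ⟨1, by omega⟩ = false then -1 else 1)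

open scoped Classical in
/-- **The cyclic signed sum** `Σ_{v cyclic hard-core} 2^{#zeros} (−1)^{#{cyclic zero pairs at distance two}}` (for `j ≥ 2`,
i.e. cycle length `≥ 4`, every cyclic pair at distance two is counted exactly once) — the closed-walk sum `C_D(n)`.
[cite: Stanley2012EC1, §4.7, Corollary 4.7.3 and Example 4.7.6 (cyclic restriction via closed walks; pp. 501–503)] -/
def cycSum (j : ℕ) : ℝ := ∑ v : Fin (j + 2) → Bool, if CycOK v then cycWt v else 0

/-- Indicator initial weight (plumbing for the first/last-letter split). [folklore] -/
def ind (a₀ a₁ : Bool) : Bool → Bool → ℝ := fun p q => if (p = a₀ ∧ q = a₁) then 1 else 0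

/-- `|ind| ≤ 1`. [folklore] -/
private theorem abs_ind_le (a₀ a₁ p q : Bool) : |ind a₀ a₁ p q| ≤ 1 := by
  unfold ind; split_ifs <;> norm_num

/-- Wrap coefficient for first letters `(a₀, a₁)` and last letters `(b, c)` (plumbing for the first/last-letter split). [folklore] -/
def wrap (a₀ a₁ b c : Bool) : ℝ :=
  (if (c = false ∧ a₀ = false) then 0 else 1) * (if (b = false ∧ a₀ = false) then -1 else 1) *
    (if (c = false ∧ a₁ = false) then -1 else 1)

/-- `|wrap| ≤ 1`. [folklore] -/
private theorem abs_wrap_le (a₀ a₁ b c : Bool) : |wrap a₀ a₁ b c| ≤ 1 := by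
  unfold wrap; split_ifs <;> norm_num

/-- The term of the first/last-letter split indexed by `q = (a₀, a₁, b, c)` (plumbing). [folklore] -/
def term (j : ℕ) (q : Bool × Bool × Bool × Bool) : ℝ := wrap q.1 q.2.1 q.2.2.1 q.2.2.2 * esum (ind q.1 q.2.1) j q.2.2.1 q.2.2.2

/-- **First/last-letter split of the cyclic sum**: `cycSum j = Σ_{(a₀,a₁,b,c)} wrap a₀ a₁ b c · esum (ind a₀ a₁) j b c`
(closed walks as walks between fixed end states; the split replaces the trace of Corollary 4.7.3 and is supplied here).
[cite: Stanley2012EC1, §4.7, Corollary 4.7.3 and Example 4.7.6 (cyclic restriction via closed walks; pp. 501–503)] -/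
theorem cycSum_eq (j : ℕ) : cycSum j = ∑ q : Bool × Bool × Bool × Bool, term j q := by
  classical
  have hrhs : (∑ q : Bool × Bool × Bool × Bool, term j q) =
      ∑ q : Bool × Bool × Bool × Bool, ∑ v : Fin (j + 2) → Bool,
        wrap q.1 q.2.1 q.2.2.1 q.2.2.2 *
          (if (NoAdj v ∧ v ⟨j, by omega⟩ = q.2.2.1 ∧ v (Fin.last (j + 1)) = q.2.2.2)
            then ind q.1 q.2.1 (v 0) (v ⟨1, by omega⟩) * wt v else 0) := by
    refine sum_congr rfl fun q _ => ?_
    unfold term esum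
    rw [mul_sum]
  rw [hrhs, sum_comm]
  unfold cycSum
  refine sum_congr rfl fun v _ => ?_
  simp only [Fintype.sum_prod_type, Fintype.sum_bool]
  unfold CycOK cycWt wrap ind
  by_cases hN : NoAdj v
  · cases h0 : v 0 <;> cases h1 : v ⟨1, by omega⟩ <;> cases hj : v ⟨j, by omega⟩ <;> cases hl : v (Fin.last (j + 1)) <;>
      simp [hN]
  · simp [hN]

/-- **MAIN BOUND.** `|cycSum j| ≤ 16 · √(4054 · 3^j)`: the signed count of cyclic hard-core words of length `j + 2`
(fugacity `2` per zero, sign `−1` per zero pair at cyclic distance two) is `O(3^{j/2})`, exponentially small against the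
total fugacity-2 mass `≍ 2^{j+2}` of the hard-core gas on the cycle.
[cite: Stanley2012EC1, §4.7, Corollary 4.7.3 / 4.7.4 (closed-walk sums = power sums of the eigenvalues); explicit bound supplied here] -/
theorem abs_cycSum_le (j : ℕ) : |cycSum j| ≤ 16 * Real.sqrt (4054 * 3 ^ j) := by
  classical
  rw [cycSum_eq]
  have hterm : ∀ q : Bool × Bool × Bool × Bool, |term j q| ≤ Real.sqrt (4054 * 3 ^ j) := by
    intro q
    unfold term
    rw [abs_mul]
    have h1 := abs_wrap_le q.1 q.2.1 q.2.2.1 q.2.2.2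
    have h2 := abs_esum_le (ind q.1 q.2.1) (abs_ind_le q.1 q.2.1) j q.2.2.1 q.2.2.2
    have h3 : 0 ≤ Real.sqrt (4054 * 3 ^ j) := Real.sqrt_nonneg _
    nlinarith [abs_nonneg (wrap q.1 q.2.1 q.2.2.1 q.2.2.2), abs_nonneg (esum (ind q.1 q.2.1) j q.2.2.1 q.2.2.2)]
  calc |∑ q : Bool × Bool × Bool × Bool, term j q| ≤ ∑ q : Bool × Bool × Bool × Bool, |term j q| := abs_sum_le_sum_abs _ _
    _ ≤ ∑ _q : Bool × Bool × Bool × Bool, Real.sqrt (4054 * 3 ^ j) := sum_le_sum fun q _ => hterm q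
    _ = 16 * Real.sqrt (4054 * 3 ^ j) := by simp

/-- Rational corollary: `|cycSum j| ≤ 1024 · (7/4)^j` (use `√4054 < 64` and `√3 < 7/4`).
[cite: Stanley2012EC1, §4.7, Corollary 4.7.3 / 4.7.4; explicit bound supplied here] -/
theorem abs_cycSum_le' (j : ℕ) : |cycSum j| ≤ 1024 * (7 / 4 : ℝ) ^ j := by
  have h := abs_cycSum_le j
  have hs : Real.sqrt (4054 * 3 ^ j) ≤ 64 * (7 / 4 : ℝ) ^ j := by
    rw [show (64 : ℝ) * (7 / 4) ^ j = Real.sqrt ((64 * (7 / 4 : ℝ) ^ j) ^ 2) by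
      rw [Real.sqrt_sq (by positivity)]]
    apply Real.sqrt_le_sqrt
    rw [mul_pow, ← pow_mul, show ((7 / 4 : ℝ) ^ (j * 2)) = ((7/4 : ℝ) ^ 2) ^ j by rw [mul_comm, pow_mul]]
    have : (3 : ℝ) ^ j ≤ ((7 / 4 : ℝ) ^ 2) ^ j := pow_le_pow_left₀ (by norm_num) (by norm_num) j
    nlinarith [pow_nonneg (show (0:ℝ) ≤ 3 by norm_num) j]
  linarith

end HardCorePairs2

end Literature.Probability.LatticeModels
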